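import Literature.Probability.Percolation.PortCount
import HarnessLib

/-!
# Counting the ports in the presence of excised squares

Topic `Probability/Percolation`.  Support file (definitions and proofs, no named fact) for step (C)
of the proof of Schramm–Smirnov's Prop. 4.1 (Ann. Probab. 39 (2011), §4).  In the printed proof the
configuration is modified near the junction points (`ω̃`, "tiles intersecting the disks `B(x_j, s)`
are declared open or closed"); in the lattice construction of the tree the excised sites form a set
`SQ` OUTSIDE the window, all of whose edges are closed in the modified configuration and never
examined.  `PortCount.lean` classifies the out-cells of the traced loop under the hypotheses that
every site outside the window is a hub vertex (`hfarO`) and every edge leaving the window is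
examined (`hX`); both fail at the squares.  Here the classification and the owner count are redone
with a FOURTH kind of out-cell, the **square bond cells** (bond cells of edges with an endpoint in
`SQ`): they behave like closed contacts, except that a transition from a square contact to an open
contact need not be a landing — there are at most `#(square sides)` such transitions, a
deterministic quantity of the geometry.

* `TileData.IsSqCell`, `TileData.out_classification_sq` — hub, closed, pocket or square;
* `TileData.IsClosedCell'` (closed or square), `isOpenSide_or_isClosedCell'`;
* `TileData.sqSides`, `TileData.transitions'`, `card_transitions'_le` — transitions are landings
  (two per landing edge) or square sides;
* `TileData.exists_owners_sq` — **the owners of the hub contacts are few**: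
  `#R ≤ max 1 (2 · #landings + #sqSides)`.

## References

* O. Schramm, S. Smirnov, *On the scaling limits of planar percolation*, Ann. Probab. 39 (2011)
  1768–1814, arXiv:1101.5820, §4, proof of Prop. 4.1 (the modification `ω̃`; "on `¬S` the number
  of bays is bounded"). [SchrammSmirnov2011]
-/

noncomputable section

open Set Relation
open Literature.Probability.LatticeModels
open scoped Classical

namespace Literature.Probability.Percolation

namespace CellComplex

namespace TileData

variable {𝒯 : TileData} {d₀ : Site 2 × Fin 4} {SQ : Set (Site 2)}

/-! ### Square bond cells -/

variable (𝒯 SQ) in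
/-- **Square bond cells**: bond cells of lattice edges with an endpoint in the excised set `SQ`.
[cite: SchrammSmirnov2011, §4, proof of Prop. 4.1 (the modified configuration ω̃)] -/
def IsSqCell (c : Site 2) : Prop := ∃ (y : Site 2) (m : Fin 4), c = βc y m ∧ (y ∈ SQ ∨ y + cornerUnit m ∈ SQ)

variable (𝒯 SQ) in
/-- **Closed or square cells.** [folklore] -/
def IsClosedCell' (c : Site 2) : Prop := 𝒯.IsClosedCell c ∨ IsSqCell SQ c

/-- A site cell is not a square bond cell. [folklore] -/
theorem not_isSqCell_σc (v : Site 2) : ¬ IsSqCell SQ (σc v) := by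
  rintro ⟨y, m, h, -⟩; exact σc_ne_βc v y m h

/-- A face cell is not a square bond cell. [folklore] -/
theorem not_isSqCell_φc (f : Site 2) : ¬ IsSqCell SQ (φc f) := by
  rintro ⟨y, m, h, -⟩; exact βc_ne_φc y f m h.symm

section Sq

variable (hSQW : ∀ q ∈ SQ, q ∉ 𝒯.Wv) (hSQO : ∀ q ∈ SQ, q ∉ 𝒯.O)
include hSQW hSQO

omit hSQW in
/-- A square bond cell is not a hub cell (a hub edge has hub endpoints). [folklore] -/
theorem not_isHubCell_of_isSqCell {c : Site 2} (h : IsSqCell SQ c) : ¬ 𝒯.IsHubCell c := by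
  rintro (⟨v, -, rfl⟩ | ⟨y', m', hhub, rfl⟩)
  · exact not_isSqCell_σc v h
  · obtain ⟨y, m, hc, hq⟩ := h
    have he : dartEdge y' m' = dartEdge y m :=
      bcell_injOn (dartEdge_mem_edgeSet _ _) (dartEdge_mem_edgeSet _ _) (by rw [bcell_dartEdge, bcell_dartEdge, hc])
    rcases hq with hq | hq
    · exact hSQO _ hq (𝒯.hub_O _ hhub y (he ▸ mem_dartEdge_iff.2 (Or.inl rfl)))
    · exact hSQO _ hq (𝒯.hub_O _ hhub _ (he ▸ mem_dartEdge_iff.2 (Or.inr rfl)))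

omit hSQO in
/-- A square bond cell is not a pocket cell (a pocket edge has window endpoints). [folklore] -/
theorem not_isPocketCell_of_isSqCell {c : Site 2} (h : IsSqCell SQ c) : ¬ 𝒯.IsPocketCell c := by
  rintro ⟨y', m', rfl, -, -, -, hy', hym'⟩
  obtain ⟨y, m, hc, hq⟩ := h
  have he : dartEdge y' m' = dartEdge y m :=
    bcell_injOn (dartEdge_mem_edgeSet _ _) (dartEdge_mem_edgeSet _ _) (by rw [bcell_dartEdge, bcell_dartEdge, hc])
  have hmem : ∀ w ∈ dartEdge y m, w ∈ 𝒯.Wv := by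
    intro w hw
    rw [← he] at hw
    rcases mem_dartEdge_iff.1 hw with rfl | rfl
    · exact hy'
    · exact hym'
  rcases hq with hq | hq
  · exact hSQW _ hq (hmem y (mem_dartEdge_iff.2 (Or.inl rfl)))
  · exact hSQW _ hq (hmem _ (mem_dartEdge_iff.2 (Or.inr rfl)))

/-- A closed-or-square cell is neither a hub cell nor a pocket cell. [folklore] -/
theorem not_open_of_isClosedCell' (hdisj : ∀ e ∈ 𝒯.hubE, e ∉ 𝒯.clE) {c : Site 2} (h : 𝒯.IsClosedCell' SQ c) :
    ¬ 𝒯.IsHubCell c ∧ ¬ 𝒯.IsPocketCell c := by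
  rcases h with h | h
  · exact not_open_of_isClosedCell hdisj h
  · exact ⟨not_isHubCell_of_isSqCell hSQO h, not_isPocketCell_of_isSqCell hSQW h⟩

/-! ### The classification with squares -/

variable (hT : 𝒯.Terminal) (hfarO : ∀ u, u ∉ 𝒯.Wv → u ∈ 𝒯.O ∨ u ∈ SQ)
  (hX : ∀ e ∈ (zdGraph 2).edgeSet, (∃ v ∈ e, v ∈ 𝒯.Wv) → (∃ u ∈ e, u ∉ 𝒯.Wv) →
    e ∈ 𝒯.hubE ∨ e ∈ 𝒯.clE ∨ ∃ q ∈ e, q ∈ SQ)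
include hT hfarO hX

omit hSQW hSQO in
/-- **Out-cells are hub, closed, pocket or square cells** when every site outside the window is a hub
vertex or an excised site and every edge leaving the window is examined or touches a square.
[cite: SchrammSmirnov2011, §4, proof of Prop. 4.1 (the modification ω̃)] -/
theorem out_classification_sq {d : Site 2 × Fin 4} (hd : IsBd 𝒯.U d) :
    𝒯.IsHubCell (faceAt d.1 (d.2 + 3)) ∨ 𝒯.IsClosedCell (faceAt d.1 (d.2 + 3)) ∨
      (𝒯.IsPocketCell (faceAt d.1 (d.2 + 3)) ∧ ∃ f, faceAt d.1 d.2 = φc f) ∨ IsSqCell SQ (faceAt d.1 (d.2 + 3)) := by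
  rcases out_classification hd with h | h | h | ⟨y, m, hc, hW⟩
  · exact Or.inl h
  · exact Or.inr (Or.inl h)
  · exact Or.inr (Or.inr (Or.inl h))
  · set e := dartEdge y m with he
    -- a square endpoint settles it
    by_cases hsq : y ∈ SQ ∨ y + cornerUnit m ∈ SQ
    · exact Or.inr (Or.inr (Or.inr ⟨y, m, hc, hsq⟩))
    push Not at hsq
    by_cases hwin : ∃ v ∈ e, v ∈ 𝒯.Wv
    · have hout : ∃ u ∈ e, u ∉ 𝒯.Wv := by
        rcases hW with h' | h'
        · exact ⟨y, mem_dartEdge_iff.2 (Or.inl rfl), h'⟩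
        · exact ⟨_, mem_dartEdge_iff.2 (Or.inr rfl), h'⟩
      rcases hX e (dartEdge_mem_edgeSet _ _) hwin hout with h' | h' | ⟨q, hq, hqSQ⟩
      · exact Or.inl (Or.inr ⟨y, m, h', hc⟩)
      · exact Or.inr (Or.inl (Or.inl ⟨e, h', dartEdge_mem_edgeSet _ _, by rw [hc, he, bcell_dartEdge]⟩))
      · rcases mem_dartEdge_iff.1 hq with rfl | rfl
        · exact absurd hqSQ hsq.1
        · exact absurd hqSQ hsq.2
    · -- both endpoints outside the window and not excised: hub vertices, and the in-cell is wet or hub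
      push Not at hwin
      have hyW : y ∉ 𝒯.Wv := hwin y (mem_dartEdge_iff.2 (Or.inl rfl))
      have hyO : y ∈ 𝒯.O := (hfarO y hyW).resolve_right hsq.1
      exfalso
      obtain ⟨hin, hout⟩ := hd
      rw [hc] at hout
      obtain ⟨v, k⟩ := d
      simp only at hin hout hc ⊢
      obtain ⟨y', j', rfl⟩ := exists_corner_eq v
      obtain ⟨t, rfl⟩ := fin4_exists_add j' k
      rcases (show t = 0 ∨ t = 1 ∨ t = 2 ∨ t = 3 by fin_cases t <;> simp) with rfl | rfl | rfl | rfl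
      · rw [add_zero, faceAt_corner_self] at hin
        rw [add_zero, faceAt_corner_add_three] at hc
        obtain ⟨-, a, ha, hya⟩ := (σc_mem_U_iff 𝒯).1 hin
        have : y' ∈ e := by
          have h1 : dartEdge y' (j' + 3) = e :=
            bcell_injOn (dartEdge_mem_edgeSet _ _) (dartEdge_mem_edgeSet _ _) (by rw [bcell_dartEdge, bcell_dartEdge, hc])
          rw [← h1]; exact mem_dartEdge_iff.2 (Or.inl rfl)
        exact hwin y' this (𝒯.acc_window a ha y' hya)
      · rw [faceAt_corner_add_one] at hin
        rw [fin4_add_one_add_three, faceAt_corner_self] at hc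
        exact σc_ne_βc y' y m hc
      · rw [faceAt_corner_add_two] at hin
        rw [fin4_add_two_add_three, faceAt_corner_add_one] at hc
        obtain ⟨hfD, -⟩ := (φc_mem_U_iff 𝒯).1 hin
        have h1 : dartEdge y' (j' + 2) = e :=
          bcell_injOn (dartEdge_mem_edgeSet _ _) (dartEdge_mem_edgeSet _ _) (by rw [bcell_dartEdge, bcell_dartEdge, hc])
        have hy'e : y' ∈ e := h1 ▸ mem_dartEdge_iff.2 (Or.inl rfl)
        have hy'W : y' ∉ 𝒯.Wv := hwin y' hy'e
        have hy'SQ : y' ∉ SQ := by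
          rcases mem_dartEdge_iff.1 hy'e with h' | h'
          · rw [h']; exact hsq.1
          · rw [h']; exact hsq.2
        have hy'O : y' ∈ 𝒯.O := (hfarO y' hy'W).resolve_right hy'SQ
        exact hfD (hT.far_wet y' _ hy'O hy'W (touchesFace_iff_exists_faceAt.2 ⟨j' + 2, rfl⟩))
      · rw [faceAt_corner_add_three] at hin
        rw [fin4_add_three_add_three, faceAt_corner_add_two] at hc
        exact βc_ne_φc y _ m hc.symm

/-! ### Transitions with squares -/

variable (h₀ : IsBd 𝒯.U d₀) (hdisj : ∀ e ∈ 𝒯.hubE, e ∉ 𝒯.clE)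
  (hfar : ∀ c c' u₁ u₂ : Site 2, c ∈ 𝒯.O → c' ∈ 𝒯.O → (∃ f, TouchesFace c f ∧ TouchesFace c' f) →
    u₁ ∉ 𝒯.Wv → u₂ ∉ 𝒯.Wv → ReflTransGen (fun a b => s(a, b) ∈ 𝒯.hubE) c u₁ →
    ReflTransGen (fun a b => s(a, b) ∈ 𝒯.hubE) c' u₂ → ReflTransGen (FarAdj 𝒯) u₂ u₁)

variable (𝒯 d₀ SQ) in
omit hSQW hSQO hT hfarO hX in
/-- **Square sides**: indices in a period whose out-cell is a square bond cell. [folklore] -/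
def sqSides (h₀ : IsBd 𝒯.U d₀) : Finset ℕ :=
  (Finset.range (period h₀)).filter fun i => IsSqCell SQ (𝒯.outCell d₀ i)

variable (𝒯 d₀ SQ) in
omit hSQW hSQO hT hfarO hX in
/-- **Transitions (with squares)**: indices in a period where a closed-or-square contact is followed by an
open one. [folklore] -/
def transitions' (h₀ : IsBd 𝒯.U d₀) : Finset ℕ :=
  (Finset.range (period h₀)).filter fun i => 𝒯.IsClosedCell' SQ (𝒯.outCell d₀ i) ∧ 𝒯.IsOpenSide d₀ (i + 1)

include h₀ in
omit hSQW hSQO hT hfarO hX in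
/-- **Transitions are landings or square sides**: at most two per landing edge, plus the square sides.
[folklore] -/
theorem card_transitions'_le :
    (𝒯.transitions' d₀ SQ h₀).card ≤ 2 * (𝒯.landings).card + (𝒯.sqSides d₀ SQ h₀).card := by
  classical
  have hsub : 𝒯.transitions' d₀ SQ h₀ ⊆ 𝒯.transitions d₀ h₀ ∪ 𝒯.sqSides d₀ SQ h₀ := by
    intro i hi
    obtain ⟨hiP, hcl, hop⟩ := Finset.mem_filter.1 hi
    rcases hcl with hcl | hsq
    · exact Finset.mem_union_left _ (Finset.mem_filter.2 ⟨hiP, hcl, hop⟩)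
    · exact Finset.mem_union_right _ (Finset.mem_filter.2 ⟨hiP, hsq⟩)
  calc (𝒯.transitions' d₀ SQ h₀).card ≤ (𝒯.transitions d₀ h₀ ∪ 𝒯.sqSides d₀ SQ h₀).card := Finset.card_le_card hsub
    _ ≤ (𝒯.transitions d₀ h₀).card + (𝒯.sqSides d₀ SQ h₀).card := Finset.card_union_le _ _
    _ ≤ 2 * (𝒯.landings).card + (𝒯.sqSides d₀ SQ h₀).card := by
        have := card_transitions_le (𝒯 := 𝒯) h₀
        omega

include h₀ in
omit hSQW hSQO in
/-- Every side is open, or closed-or-square. [folklore] -/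
theorem isOpenSide_or_isClosedCell' (i : ℕ) : 𝒯.IsOpenSide d₀ i ∨ 𝒯.IsClosedCell' SQ (𝒯.outCell d₀ i) := by
  rcases out_classification_sq hT hfarO hX (isBd_bdOrbit h₀ i) with h | h | ⟨h, -⟩ | h
  · exact Or.inl (Or.inl h)
  · exact Or.inr (Or.inl h)
  · exact Or.inl (Or.inr h)
  · exact Or.inr (Or.inr h)

include h₀ hdisj hfar in
/-- **The owners of the hub contacts are few (with squares).**  There is a set `R` of at most
`max 1 (2 · #landings + #sqSides)` hub vertices such that every vertex attached to a hub contact of the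
loop is joined by examined open edges to a vertex of `R`.
[cite: SchrammSmirnov2011, §4, proof of Prop. 4.1 ("on ¬S the number of bays is bounded")] -/
theorem exists_owners_sq : ∃ R : Finset (Site 2),
    R.card ≤ max 1 (2 * (𝒯.landings).card + (𝒯.sqSides d₀ SQ h₀).card) ∧
    ∀ i, 𝒯.hubContact d₀ i → ∀ v ∈ 𝒯.att (𝒯.outCell d₀ i), ∃ r ∈ R, 𝒯.HubConn v r := by
  classical
  have hP0 : 0 < period h₀ := period_pos h₀
  have hout_per : ∀ i q, 𝒯.outCell d₀ (i + q * (period h₀)) = 𝒯.outCell d₀ i := outCell_add_mul_period h₀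
  have hhub_per : ∀ i q, 𝒯.hubContact d₀ (i + q * (period h₀)) ↔ 𝒯.hubContact d₀ i := fun i q => by
    simp only [TileData.hubContact, hout_per]
  have hopen_per : ∀ i q, 𝒯.IsOpenSide d₀ (i + q * (period h₀)) ↔ 𝒯.IsOpenSide d₀ i := fun i q => by
    simp only [IsOpenSide, TileData.hubContact, hout_per]
  have hcl_per : ∀ i q, 𝒯.IsClosedCell' SQ (𝒯.outCell d₀ (i + q * (period h₀))) ↔ 𝒯.IsClosedCell' SQ (𝒯.outCell d₀ i) :=
    fun i q => by rw [hout_per]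
  by_cases hall : ∀ i, i < (period h₀) → 𝒯.IsOpenSide d₀ i
  · have hopen : ∀ i, 𝒯.IsOpenSide d₀ i := by
      intro i
      have := hall (i % (period h₀)) (Nat.mod_lt _ hP0)
      rwa [← hopen_per (i % (period h₀)) (i / (period h₀)), Nat.mod_add_div'] at this
    by_cases hex : ∃ i, 𝒯.hubContact d₀ i
    · obtain ⟨i₁, hi₁⟩ := hex
      obtain ⟨w, hw⟩ := 𝒯.att_nonempty hi₁
      refine ⟨{w}, by simp, fun i hi v hv => ⟨w, Finset.mem_singleton_self _, ?_⟩⟩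
      rcases le_total i i₁ with h | h
      · exact hubConn_of_open_stretch' h₀ hT hfar h (fun l _ _ => hopen l) hi hi₁ hv hw
      · exact (hubConn_of_open_stretch' h₀ hT hfar h (fun l _ _ => hopen l) hi₁ hi hw hv).symm
    · push Not at hex
      exact ⟨∅, by simp, fun i hi => absurd hi (hex i)⟩
  · push Not at hall
    obtain ⟨i₁, hi₁P, hi₁⟩ := hall
    have hcl₁ : 𝒯.IsClosedCell' SQ (𝒯.outCell d₀ i₁) :=
      (isOpenSide_or_isClosedCell' hT hfarO hX h₀ i₁).resolve_left hi₁
    let good : ℕ → Prop := fun t => ∃ n, t < n ∧ 𝒯.hubContact d₀ n ∧ ∀ j, t < j → j ≤ n → 𝒯.IsOpenSide d₀ j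
    let rep : ℕ → Site 2 := fun t =>
      if h : good t then (𝒯.att_nonempty (Nat.find_spec h).2.1).choose else 0
    refine ⟨(𝒯.transitions' d₀ SQ h₀).image rep, ?_, ?_⟩
    · exact (Finset.card_image_le.trans (card_transitions'_le h₀)).trans (le_max_right _ _)
    · intro i hi v hv
      obtain ⟨r, k, hrP, hik⟩ : ∃ r k, r < period h₀ ∧ i = r + k * period h₀ :=
        ⟨i % period h₀, i / period h₀, Nat.mod_lt _ hP0, (Nat.mod_add_div' i _).symm⟩
      obtain ⟨n₀, hn₀⟩ : ∃ n₀, n₀ = r + 1 * period h₀ := ⟨_, rfl⟩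
      have hi' : 𝒯.hubContact d₀ n₀ := by rw [hn₀, hhub_per, ← hhub_per r k, ← hik]; exact hi
      have hv' : v ∈ 𝒯.att (𝒯.outCell d₀ n₀) := by rw [hn₀, hout_per, ← hout_per r k, ← hik]; exact hv
      have hexc : ∃ c, c < n₀ ∧ n₀ ≤ c + period h₀ ∧ 𝒯.IsClosedCell' SQ (𝒯.outCell d₀ c) := by
        by_cases hlt : r ≤ i₁
        · exact ⟨i₁, by omega, by omega, hcl₁⟩
        · refine ⟨i₁ + 1 * period h₀, by omega, by omega, ?_⟩
          rw [hcl_per]; exact hcl₁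
      set c := Nat.findGreatest (fun c => 𝒯.IsClosedCell' SQ (𝒯.outCell d₀ c)) (n₀ - 1) with hc
      obtain ⟨c₁, hc₁lt, hc₁le, hc₁cl⟩ := hexc
      have hcle : c ≤ n₀ - 1 := Nat.findGreatest_le _
      have hc₁c : c₁ ≤ c := Nat.le_findGreatest (by omega) hc₁cl
      have hccl : 𝒯.IsClosedCell' SQ (𝒯.outCell d₀ c) :=
        Nat.findGreatest_spec (P := fun c => 𝒯.IsClosedCell' SQ (𝒯.outCell d₀ c)) (by omega) hc₁cl
      have hopen_after : ∀ j, c < j → j ≤ n₀ → 𝒯.IsOpenSide d₀ j := by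
        intro j hcj hjn
        rcases (isOpenSide_or_isClosedCell' hT hfarO hX h₀ j) with h | h
        · exact h
        · exfalso
          rcases Nat.lt_or_ge j n₀ with hjn' | hjn'
          · have := Nat.le_findGreatest (P := fun c => 𝒯.IsClosedCell' SQ (𝒯.outCell d₀ c)) (n := n₀ - 1) (by omega) h
            rw [← hc] at this
            omega
          · have : j = n₀ := le_antisymm hjn hjn'
            rw [this] at h
            exact (not_open_of_isClosedCell' hSQW hSQO hdisj h).1 hi'
      obtain ⟨t, q, htP, hcq⟩ : ∃ t q, t < period h₀ ∧ c = t + q * period h₀ :=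
        ⟨c % period h₀, c / period h₀, Nat.mod_lt _ hP0, (Nat.mod_add_div' c _).symm⟩
      have htT : t ∈ 𝒯.transitions' d₀ SQ h₀ := by
        refine Finset.mem_filter.2 ⟨Finset.mem_range.2 htP, ?_, ?_⟩
        · rw [← hcl_per t q, ← hcq]; exact hccl
        · rw [← hopen_per (t + 1) q, show t + 1 + q * period h₀ = c + 1 by rw [hcq]; ring]
          exact hopen_after (c + 1) (by omega) (by omega)
      obtain ⟨m, hmn⟩ : ∃ m, m + q * period h₀ = n₀ := ⟨n₀ - q * period h₀, by omega⟩
      have hm_hub : 𝒯.hubContact d₀ m := by rw [← hhub_per m q, hmn]; exact hi'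
      have hm_att : v ∈ 𝒯.att (𝒯.outCell d₀ m) := by rw [← hout_per m q, hmn]; exact hv'
      have hm_open : ∀ j, t < j → j ≤ m → 𝒯.IsOpenSide d₀ j := by
        intro j h1 h2
        rw [← hopen_per j q]
        exact hopen_after _ (by omega) (by omega)
      have hgood : good t := ⟨m, by omega, hm_hub, hm_open⟩
      refine ⟨rep t, Finset.mem_image.2 ⟨t, htT, rfl⟩, ?_⟩
      have hrep : rep t = (𝒯.att_nonempty (Nat.find_spec hgood).2.1).choose := by
        simp only [rep, dif_pos hgood]
      obtain ⟨htn₁, hn₁hub, hn₁open⟩ := Nat.find_spec hgood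
      have hn₁m : Nat.find hgood ≤ m := Nat.find_min' hgood ⟨by omega, hm_hub, hm_open⟩
      have hw : rep t ∈ 𝒯.att (𝒯.outCell d₀ (Nat.find hgood)) := by
        rw [hrep]; exact (𝒯.att_nonempty (Nat.find_spec hgood).2.1).choose_spec
      exact (hubConn_of_open_stretch' h₀ hT hfar hn₁m (fun l h1 h2 => hm_open l (by omega) h2) hn₁hub hm_hub hw hm_att).symm

include h₀ in
omit hSQW hSQO hT hfarO hX in
/-- **Transitions out of a genuine closed contact are landings**; out of a square contact they need
not be: the dichotomy used by the coarse-graining. [folklore] -/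
theorem transition' {i : ℕ} (hcl : 𝒯.IsClosedCell' SQ (𝒯.outCell d₀ i)) (hop : 𝒯.IsOpenSide d₀ (i + 1)) :
    IsSqCell SQ (𝒯.outCell d₀ i) ∨
      ∃ y j, vert 𝒯.U d₀ (i + 1) = σc y + cornerOff j ∧ dartEdge y (j + 2) ∈ 𝒯.acc ∧ y ∈ 𝒯.O ∧
        faceAt y (j + 2) ∈ 𝒯.Dset ∧ faceAt (vert 𝒯.U d₀ i) (dirAt 𝒯.U d₀ i) = βc y (j + 2) ∧
        𝒯.outCell d₀ i = φc (faceAt y (j + 2)) := by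
  rcases hcl with hcl | hsq
  · exact Or.inr (transition hcl hop h₀)
  · exact Or.inl hsq

end Sq

end TileData

end CellComplex

end Literature.Probability.Percolation

end
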